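import Summits.CriticalPhenomena.CardyFormulaZ2.Theorems.CardySusyWardWeakHolomorphyInTemplatePairing

/-! # The full node template at spin `1/3` (assembly): `F(in₁) + F(in₂) = (2 + λ²) Z_L + (2 + λ̄²) Z_R`

Line `Sketch` of the crux `CardySusyWard.WeakHolomorphy` (stmt-CriticalPhenomena-11292), lead c3 (infrastructure,
`--supports`).  The landed Kirchhoff identity (`stub_kirchhoffIdentity`, p114738) gives ONE complex combination of the four
dart observables at an interior medial vertex `z` in terms of the once-visit chiral sums `Z_L, Z_R` (`onceChiralObs`).
The pathwise pair template for the ARRIVING darts is in the helper file `…InTemplatePairing` (`ival_case1`,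
`ival_pair_of_once`); this file integrates it.  Per pair {once-visit with arrival weight `λ^C` and turn `s`, its flip (a twice-visit: arrivals `λ^C`, `λ^{C+2s}`)}
the two arriving dart weights add up to `(2 + λ^{2s}) λ^C`, `λ = e^{-iπ/6}`.  Hence, exactly,
`F(in₁) + F(in₂) = (2 + λ²) Z_L + (2 + λ̄²) Z_R` (`inTemplateIdentity`), and with the Kirchhoff identity
`F(out₁) + F(out₂) = (2λ + λ̄) Z_L + (2λ̄ + λ) Z_R` (`outTemplateIdentity`): ALL vertex-summed statistics of the
spin-`1/3` dart observable at `z` are functions of `(Z_L, Z_R)`.  Reading: the `2` is the first-arrival phase counted on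
both members of a pair (the FIRST-ARRIVAL phase sum at `z` is exactly `2 (Z_L + Z_R)`, i.e. given the past up to the
first arrival the vertex is visited exactly once with probability `1/2`), the `λ^{±2}` the rigid second arrival of the
twice-visit.  References: Duminil-Copin–Smirnov arXiv:1109.1549 §8.3; Duminil-Copin arXiv:1208.3787 Prop. 4;
Zhou arXiv:2409.03235 §4 eq. (102); crux workfile `Cruxes/WeakHolomorphy/Lines/Sketch.md` (node template).
-/

noncomputable section

namespace Summit.CriticalPhenomena.CardyFormulaZ2.Theorems.WeakHolomorphy.SplitBypass

open scoped BigOperators symmDiff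
open MeasureTheory
open _root_.Literature.Probability.LatticeModels
open _root_.Literature.Probability.Percolation (BondConfig bondPercolation half)
open _root_.Literature.Barriers.CriticalPhenomena (medialCornersAt medialVertexOf)
open Summit.CriticalPhenomena.CardyFormulaZ2.Theorems.ParafermionFamiliesToSLESix.StripAnchored.S2
  (dartW sixthPhase sixthPhase_add dartW_eq_zero dartW_eq_single loopTurn_eq one_of_both turnSign_partner)
open Summit.CriticalPhenomena.CardyFormulaZ2.Cruxes.ParafermionPrecompact.KenyonStreamSecondRelation
  (toggle_hypotheses_symmDiff)
open _root_.Literature.Probability.LatticeModels.DiscreteDobrushin (startCorner exitTime isStartCorner_startCorner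
  medialExploration_eq_explorationList isInnerFace_of_lt_exitTime not_isInnerFace_exitTime)

/-! ## The pathwise pair identity `ival(ω) + ival(ω') = U(ω) + U(ω')`, all cases, and its integration -/

section Pathwise

variable {E : DiscreteDobrushin}

/-- **The pathwise arriving-dart pair identity, all cases** (never/never, once/twice, twice/once, as in
`kval_add_kval_toggle`): `ival(ω) + ival(ω') = U(ω) + U(ω')` with `ival` the sum of the two arriving dart weights at
`e = cTgt r` and `U = (2 + λ²) · onceChiralPhase … true + (2 + λ̄²) · onceChiralPhase … false`.
[cite: Zhou2024SLE6BondZ2, eq. (102)] -/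
theorem ival_add_ival_toggle (hE : E.IsZdAdmissible) (hH : HoleFree {f : Site 2 | E.IsInnerFace f}) {r : Site 2 × Fin 4}
    (hx : ∀ j, E.IsInnerFace (faceAt r.1 j)) (hy : ∀ j, E.IsInnerFace (faceAt (r.1 + cornerUnit (r.2 + 1)) j))
    {ω ω' : BondConfig (Site 2)} (hagree : ∀ e, e ≠ cTgt r → (e ∈ E.bcBondConfig ω' ↔ e ∈ E.bcBondConfig ω))
    (hdiff : ¬ (cTgt r ∈ E.bcBondConfig ω' ↔ cTgt r ∈ E.bcBondConfig ω)) {δ : ℝ} (hδ : δ ≠ 0) :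
    (dartW (E.bcBondConfig ω) (startCorner hE) r (exitTime hE ω) +
        dartW (E.bcBondConfig ω) (startCorner hE) (cornerPartner r) (exitTime hE ω)) +
        (dartW (E.bcBondConfig ω') (startCorner hE) r (exitTime hE ω') +
          dartW (E.bcBondConfig ω') (startCorner hE) (cornerPartner r) (exitTime hE ω')) =
      ((2 + sixthPhase 1 * sixthPhase 1) *
          onceChiralPhase (explorationList (E.bcBondConfig ω) (startCorner hE) (exitTime hE ω)) δ (1 / 3) (cTgt r) true +
        (2 + sixthPhase (-1) * sixthPhase (-1)) *
          onceChiralPhase (explorationList (E.bcBondConfig ω) (startCorner hE) (exitTime hE ω)) δ (1 / 3) (cTgt r) false) +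
      ((2 + sixthPhase 1 * sixthPhase 1) *
          onceChiralPhase (explorationList (E.bcBondConfig ω') (startCorner hE) (exitTime hE ω')) δ (1 / 3) (cTgt r) true +
        (2 + sixthPhase (-1) * sixthPhase (-1)) *
          onceChiralPhase (explorationList (E.bcBondConfig ω') (startCorner hE) (exitTime hE ω')) δ (1 / 3) (cTgt r) false) := by
  have hc₀ := isStartCorner_startCorner hE
  -- the same data for the partner
  have hyx : (cornerPartner r).1 + cornerUnit ((cornerPartner r).2 + 1) = r.1 := by
    change r.1 + cornerUnit (r.2 + 1) + cornerUnit (r.2 + 2 + 1) = r.1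
    rw [show r.2 + 2 + 1 = (r.2 + 1) + 2 by omega, cornerUnit_add_two]; abel
  have hx2 : ∀ j, E.IsInnerFace (faceAt (cornerPartner r).1 j) := hy
  have hy2 : ∀ j, E.IsInnerFace (faceAt ((cornerPartner r).1 + cornerUnit ((cornerPartner r).2 + 1)) j) := by
    rw [hyx]; exact hx
  have hagree2 : ∀ e, e ≠ cTgt (cornerPartner r) → (e ∈ E.bcBondConfig ω' ↔ e ∈ E.bcBondConfig ω) := by
    rw [cTgt_partner]; exact hagree
  have hdiff2 : ¬ (cTgt (cornerPartner r) ∈ E.bcBondConfig ω' ↔ cTgt (cornerPartner r) ∈ E.bcBondConfig ω) := by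
    rw [cTgt_partner]; exact hdiff
  have hN := not_isInnerFace_exitTime hE ω
  have hlt : ∀ k < exitTime hE ω, E.IsInnerFace (cFace (cornerOrbit (E.bcBondConfig ω) (startCorner hE) k)) :=
    fun k hk => isInnerFace_of_lt_exitTime hE ω hk
  by_cases h₁ : ∃ i, i < exitTime hE ω ∧ cornerOrbit (E.bcBondConfig ω) (startCorner hE) i = r
  · by_cases h₂ : ∃ i, i < exitTime hE ω ∧ cornerOrbit (E.bcBondConfig ω) (startCorner hE) i = cornerPartner r
    · -- twice in `ω`: once in the flipped configuration
      obtain ⟨i₁, hi₁N, hi₁⟩ := h₁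
      obtain ⟨i₂, hi₂N, hi₂⟩ := h₂
      have hne : i₁ ≠ i₂ := by rintro rfl; exact partner_ne r (hi₂.symm.trans hi₁)
      rcases Nat.lt_or_gt_of_ne hne with h12 | h21
      · obtain ⟨⟨i, hiN', hi'⟩, h₂'⟩ := one_of_both hE hagree hdiff hi₁ hi₂ h12 hi₂N
        obtain ⟨hk, hT⟩ := ival_pair_of_once hE hH hx hy (fun e hne => (hagree e hne).symm) (fun h => hdiff h.symm)
          hi' hiN' h₂' hδ
        rw [hT true, hT false]
        linear_combination hk
      · obtain ⟨⟨i, hiN', hi'⟩, h₁'⟩ := one_of_both (p := cornerPartner r) hE hagree2 hdiff2 hi₂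
          (by rw [partner_partner]; exact hi₁) h21 hi₁N
        obtain ⟨hk, hT⟩ := ival_pair_of_once (r := cornerPartner r) hE hH hx2 hy2
          (fun e hne => (hagree2 e hne).symm) (fun h => hdiff2 h.symm) hi' hiN' h₁' hδ
        rw [partner_partner, cTgt_partner] at hk
        rw [cTgt_partner] at hT
        rw [hT true, hT false]
        linear_combination hk
    · -- once in `ω`, along `r`
      obtain ⟨i₁, hi₁N, hi₁⟩ := h₁
      have h₂' : ∀ i < exitTime hE ω, cornerOrbit (E.bcBondConfig ω) (startCorner hE) i ≠ cornerPartner r :=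
        fun i hi h => h₂ ⟨i, hi, h⟩
      obtain ⟨hk, hT⟩ := ival_pair_of_once hE hH hx hy hagree hdiff hi₁ hi₁N h₂' hδ
      rw [hT true, hT false]
      linear_combination hk
  · have h₁' : ∀ i < exitTime hE ω, cornerOrbit (E.bcBondConfig ω) (startCorner hE) i ≠ r :=
      fun i hi h => h₁ ⟨i, hi, h⟩
    by_cases h₂ : ∃ i, i < exitTime hE ω ∧ cornerOrbit (E.bcBondConfig ω) (startCorner hE) i = cornerPartner r
    · -- once in `ω`, along the partner
      obtain ⟨i₂, hi₂N, hi₂⟩ := h₂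
      have h₁'' : ∀ i < exitTime hE ω,
          cornerOrbit (E.bcBondConfig ω) (startCorner hE) i ≠ cornerPartner (cornerPartner r) := by
        rw [partner_partner]; exact h₁'
      obtain ⟨hk, hT⟩ := ival_pair_of_once (r := cornerPartner r) hE hH hx2 hy2 hagree2 hdiff2 hi₂ hi₂N h₁'' hδ
      rw [partner_partner, cTgt_partner] at hk
      rw [cTgt_partner] at hT
      rw [hT true, hT false]
      linear_combination hk
    · -- never: the flipped exploration is the same path
      have h₂' : ∀ i < exitTime hE ω, cornerOrbit (E.bcBondConfig ω) (startCorner hE) i ≠ cornerPartner r :=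
        fun i hi h => h₂ ⟨i, hi, h⟩
      have hcase := cornerOrbit_toggle_case0 (c₀ := startCorner hE) hagree hdiff h₁' h₂'
      have hN' : exitTime hE ω' = exitTime hE ω :=
        exitTime_eq_of hE _ (by rw [hcase _ le_rfl]; exact hN) (fun k hk => by rw [hcase k hk.le]; exact hlt k hk)
      have h₁'' : ∀ i < exitTime hE ω, cornerOrbit (E.bcBondConfig ω') (startCorner hE) i ≠ r :=
        fun i hi h => h₁' i hi (by rw [← hcase i hi.le]; exact h)
      have h₂'' : ∀ i < exitTime hE ω, cornerOrbit (E.bcBondConfig ω') (startCorner hE) i ≠ cornerPartner r :=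
        fun i hi h => h₂' i hi (by rw [← hcase i hi.le]; exact h)
      rw [hN', dartW_eq_zero h₁', dartW_eq_zero h₂', dartW_eq_zero h₁'', dartW_eq_zero h₂'',
        onceChiralPhase_explorationList_never h₁' h₂', onceChiralPhase_explorationList_never h₁' h₂',
        onceChiralPhase_explorationList_never h₁'' h₂'', onceChiralPhase_explorationList_never h₁'' h₂'']
      ring

/-- **Assembly**: a functional `H` of the configuration which is pathwise a constant multiple of `ival − U` at an interior
edge `e = cTgt r` has zero `P_{1/2}`-expectation (flip `e`: `H ∘ flip = −H`, and `P_{1/2}` is flip invariant).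
[cite: Zhou2024SLE6BondZ2, eq. (102)] -/
theorem integral_eq_zero_of_eq_mul_ival_sub (hE : E.IsZdAdmissible) (hH : HoleFree {f : Site 2 | E.IsInnerFace f})
    {r : Site 2 × Fin 4} (hx : ∀ j, E.IsInnerFace (faceAt r.1 j))
    (hy : ∀ j, E.IsInnerFace (faceAt (r.1 + cornerUnit (r.2 + 1)) j)) (q₂ : Site 2 × Fin 4) (hq₂ : q₂ = cornerPartner r)
    (κ : ℂ) {δ : ℝ} (hδ : δ ≠ 0) (H : BondConfig (Site 2) → ℂ)
    (hHr : ∀ ω, H ω = κ * (dartW (E.bcBondConfig ω) (startCorner hE) r (exitTime hE ω) +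
      dartW (E.bcBondConfig ω) (startCorner hE) q₂ (exitTime hE ω) -
      ((2 + sixthPhase 1 * sixthPhase 1) *
          onceChiralPhase (explorationList (E.bcBondConfig ω) (startCorner hE) (exitTime hE ω)) δ (1 / 3) (cTgt r) true +
        (2 + sixthPhase (-1) * sixthPhase (-1)) *
          onceChiralPhase (explorationList (E.bcBondConfig ω) (startCorner hE) (exitTime hE ω)) δ (1 / 3) (cTgt r) false))) :
    ∫ ω, H ω ∂(bondPercolation (zdGraph 2) half) = 0 := by
  subst hq₂
  have hanti : ∀ ω, H (ω ∆ {cTgt r}) = -H ω := by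
    intro ω
    obtain ⟨hagree, hdiff, -⟩ := toggle_hypotheses_symmDiff hx hy ω
    rw [hHr, hHr]
    have := ival_add_ival_toggle hE hH hx hy hagree hdiff hδ
    linear_combination κ * this
  have h1 := integral_comp_symmDiff (cTgt_mem_edgeSet r) H
  simp only [hanti, integral_neg] at h1
  linear_combination (-1 / 2 : ℂ) * h1

end Pathwise

/-! ## The identities for the dart observable -/

section Assembly

variable {E : DiscreteDobrushin}

/-- **The arriving sum minus the once-visit template as one expectation**: `F(c) + F(c') − ((2+λ²) Z_L + (2+λ̄²) Z_R)` is
the expectation of the pathwise combination (all bounded functions of the path). [folklore] -/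
theorem inSum_eq_integral (E : DiscreteDobrushin) (c c' : Site 2 × Site 2) (δ : ℝ) (z : MedialVertex) :
    bondDartObservable E δ (1 / 3) c + bondDartObservable E δ (1 / 3) c' -
        ((2 + sixthPhase 1 * sixthPhase 1) * onceChiralObs E δ (1 / 3) z true +
          (2 + sixthPhase (-1) * sixthPhase (-1)) * onceChiralObs E δ (1 / 3) z false) =
      ∫ ω, (dartPhaseSum (medialExploration E ω) δ (1 / 3) c + dartPhaseSum (medialExploration E ω) δ (1 / 3) c' -
        ((2 + sixthPhase 1 * sixthPhase 1) * onceChiralPhase (medialExploration E ω) δ (1 / 3) z true +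
          (2 + sixthPhase (-1) * sixthPhase (-1)) * onceChiralPhase (medialExploration E ω) δ (1 / 3) z false))
        ∂(bondPercolation (zdGraph 2) half) := by
  have hint : ∀ c, Integrable (fun ω => dartPhaseSum (medialExploration E ω) δ (1 / 3) c) (bondPercolation (zdGraph 2) half) :=
    fun c => integrable_dartPhaseSum_exploration E δ _ c
  have hT : ∀ (b : Bool) (a : ℂ), Integrable (fun ω => a * onceChiralPhase (medialExploration E ω) δ (1 / 3) z b)
      (bondPercolation (zdGraph 2) half) := fun b a => (integrable_onceChiralPhase_exploration E δ _ z b).const_mul _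
  have hAB : Integrable (fun ω => dartPhaseSum (medialExploration E ω) δ (1 / 3) c +
      dartPhaseSum (medialExploration E ω) δ (1 / 3) c') (bondPercolation (zdGraph 2) half) := (hint _).add (hint _)
  have hTT : Integrable (fun ω => ((2 + sixthPhase 1 * sixthPhase 1) * onceChiralPhase (medialExploration E ω) δ (1 / 3) z true +
      (2 + sixthPhase (-1) * sixthPhase (-1)) * onceChiralPhase (medialExploration E ω) δ (1 / 3) z false))
      (bondPercolation (zdGraph 2) half) := (hT true _).add (hT false _)
  simp only [Parafermion.bondDartObservable_def, onceChiralObs]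
  rw [integral_sub hAB hTT, integral_add (hint _) (hint _), integral_add (hT true _) (hT false _), integral_const_mul,
    integral_const_mul]

/-- `λ² = e^{-iπ/3}`-type bookkeeping: `sixthPhase 1 * sixthPhase 1 = exp(-iπ/6)^2` and the conjugate. [folklore] -/
theorem sixthPhase_sq_eq :
    sixthPhase 1 * sixthPhase 1 = Complex.exp (-(Real.pi / 6 : ℝ) * Complex.I) ^ 2 ∧
      sixthPhase (-1) * sixthPhase (-1) = Complex.exp ((Real.pi / 6 : ℝ) * Complex.I) ^ 2 := by
  rw [exp_pi_div_six_eq.1, exp_pi_div_six_eq.2, sq, sq]; exact ⟨rfl, rfl⟩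

/-- **The arriving-dart template identity** at an interior medial vertex of hole-free `ℤ²`-admissible Dobrushin data:
the two ARRIVING spin-`1/3` dart observables at the edge `p` (corners `NE, SW = 1, 3` at a horizontal edge, `NW, SE = 0, 2`
at a vertical one) add up to `(2 + λ²) Z_L + (2 + λ̄²) Z_R`, `λ = e^{-iπ/6}`, `Z_t = onceChiralObs E δ (1/3) z t`.
(The `2 (Z_L + Z_R)` part is the first-arrival phase sum — each once/twice pair shares its first arrival —, the
`λ² Z_L + λ̄² Z_R` part the rigid second arrivals of the twice-visits.) [cite: Zhou2024SLE6BondZ2, eq. (102)] -/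
theorem inTemplateIdentity (hE : E.IsZdAdmissible) (hH : HoleFree {f : Site 2 | E.IsInnerFace f})
    (p : Site 2 × Fin 2) (hp : medialVertexOf p ∈ (discreteDomainGraph E.Ω E.δ).edgeSet ∧
      (∀ x ∈ medialVertexOf p, x ∉ E.zdArcA ∧ x ∉ E.zdArcB) ∧
      ∀ f : Site 2, IsCorner p.1 f → IsCorner (p.1 + Pi.single p.2 1) f → E.IsInnerFace f) {δ : ℝ} (hδ : 0 < δ) :
    bondDartObservable E δ (1 / 3) (medialCornersAt p.1 p.2 (if p.2 = 0 then 1 else 0)) +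
        bondDartObservable E δ (1 / 3) (medialCornersAt p.1 p.2 (if p.2 = 0 then 3 else 2)) =
      (2 + Complex.exp (-(Real.pi / 6 : ℝ) * Complex.I) ^ 2) * onceChiralObs E δ (1 / 3) (medialVertexOf p) true +
        (2 + Complex.exp ((Real.pi / 6 : ℝ) * Complex.I) ^ 2) * onceChiralObs E δ (1 / 3) (medialVertexOf p) false := by
  classical
  obtain ⟨hx0, hy0⟩ := isInnerFace_faceAt_of_interior hE hp
  rw [← sixthPhase_sq_eq.1, ← sixthPhase_sq_eq.2, ← sub_eq_zero, inSum_eq_integral]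
  obtain ⟨x, i⟩ := p
  obtain rfl | rfl : i = 0 ∨ i = 1 := by fin_cases i <;> simp
  · -- horizontal medial vertex `s(x, x + e₀)`: arriving corners `r = (x, 3) = SW` and `(x + e₀, 1) = NE`
    refine integral_eq_zero_of_eq_mul_ival_sub hE hH (r := (x, 3)) hx0 hy0 (x + Pi.single 0 1, 1) rfl 1 hδ.ne' _
      fun ω => ?_
    dsimp only
    rw [if_pos rfl, if_pos rfl, show medialVertexOf (x, (0 : Fin 2)) = cTgt (x, 3) from rfl,
      medialExploration_eq_explorationList hE ω,
      dartPhaseSum_eq_dartW hδ.ne' _ (x + Pi.single 0 1, 1) (medialCornersAt x 0 1)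
        (by simp [medialCornersAt]) (by simp [medialCornersAt, cFace, faceAt, cornerOff]),
      dartPhaseSum_eq_dartW hδ.ne' _ (x, 3) (medialCornersAt x 0 3) rfl (by simp [medialCornersAt, cFace, faceAt, cornerOff])]
    ring
  · -- vertical medial vertex `s(x, x + e₁)`: arriving corners `r = (x, 0) = SE` and `(x + e₁, 2) = NW`
    refine integral_eq_zero_of_eq_mul_ival_sub hE hH (r := (x, 0)) hx0 hy0 (x + Pi.single 1 1, 2) rfl 1 hδ.ne' _
      fun ω => ?_
    dsimp only
    rw [if_neg (show ¬ ((1 : Fin 2) = 0) by decide), if_neg (show ¬ ((1 : Fin 2) = 0) by decide),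
      show medialVertexOf (x, (1 : Fin 2)) = cTgt (x, 0) from rfl, medialExploration_eq_explorationList hE ω,
      dartPhaseSum_eq_dartW hδ.ne' _ (x + Pi.single 1 1, 2) (medialCornersAt x 1 0)
        (by simp [medialCornersAt]) (by simp [medialCornersAt, cFace, faceAt, cornerOff]),
      dartPhaseSum_eq_dartW hδ.ne' _ (x, 0) (medialCornersAt x 1 2) rfl (by simp [medialCornersAt, cFace, faceAt, cornerOff])]
    ring

/-- **The leaving-dart template identity** (from `inTemplateIdentity` and the Kirchhoff identity `kirchhoffIdentity`,
`(2 + λ²) − κ_L = 2λ + λ̄`): the two LEAVING spin-`1/3` dart observables at an interior medial vertex (corners `NW, SE = 0, 2`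
at a horizontal edge, `NE, SW = 1, 3` at a vertical one) add up to `(2λ + λ̄) Z_L + (2λ̄ + λ) Z_R`.
[cite: Zhou2024SLE6BondZ2, eq. (102)] -/
theorem outTemplateIdentity (hE : E.IsZdAdmissible) (hH : HoleFree {f : Site 2 | E.IsInnerFace f})
    (p : Site 2 × Fin 2) (hp : medialVertexOf p ∈ (discreteDomainGraph E.Ω E.δ).edgeSet ∧
      (∀ x ∈ medialVertexOf p, x ∉ E.zdArcA ∧ x ∉ E.zdArcB) ∧
      ∀ f : Site 2, IsCorner p.1 f → IsCorner (p.1 + Pi.single p.2 1) f → E.IsInnerFace f) {δ : ℝ} (hδ : 0 < δ) :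
    bondDartObservable E δ (1 / 3) (medialCornersAt p.1 p.2 (if p.2 = 0 then 0 else 1)) +
        bondDartObservable E δ (1 / 3) (medialCornersAt p.1 p.2 (if p.2 = 0 then 2 else 3)) =
      (2 * Complex.exp (-(Real.pi / 6 : ℝ) * Complex.I) + Complex.exp ((Real.pi / 6 : ℝ) * Complex.I)) *
          onceChiralObs E δ (1 / 3) (medialVertexOf p) true +
        (2 * Complex.exp ((Real.pi / 6 : ℝ) * Complex.I) + Complex.exp (-(Real.pi / 6 : ℝ) * Complex.I)) *
          onceChiralObs E δ (1 / 3) (medialVertexOf p) false := by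
  have hin := inTemplateIdentity hE hH p hp hδ
  have hK := kirchhoffIdentity hE hH p hp hδ
  rw [onceKappa, onceKappa, if_pos rfl, if_neg Bool.false_ne_true] at hK
  obtain ⟨x, i⟩ := p
  obtain rfl | rfl : i = 0 ∨ i = 1 := by fin_cases i <;> simp
  · rw [if_pos rfl] at hK
    rw [if_pos rfl, if_pos rfl] at hin ⊢
    linear_combination hin - hK
  · rw [if_neg (show ¬ ((1 : Fin 2) = 0) by decide)] at hK
    rw [if_neg (show ¬ ((1 : Fin 2) = 0) by decide), if_neg (show ¬ ((1 : Fin 2) = 0) by decide)] at hin ⊢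
    linear_combination hin + hK

end Assembly

/-- **Registered one-line form of `inTemplateIdentity`**: the arriving spin-`1/3` dart observables at an interior medial
vertex of hole-free admissible data add up to `(2 + λ²) Z_L + (2 + λ̄²) Z_R` (exact, finite).
[cite: Zhou2024SLE6BondZ2, eq. (102)] -/
theorem stub_inTemplateIdentity : ∀ (E : DiscreteDobrushin), E.IsZdAdmissible → HoleFree {f : Site 2 | E.IsInnerFace f} → ∀ p : Site 2 × Fin 2, (medialVertexOf p ∈ (discreteDomainGraph E.Ω E.δ).edgeSet ∧ (∀ x ∈ medialVertexOf p, x ∉ E.zdArcA ∧ x ∉ E.zdArcB) ∧ ∀ f : Site 2, IsCorner p.1 f → IsCorner (p.1 + Pi.single p.2 1) f → E.IsInnerFace f) → ∀ δ : ℝ, 0 < δ → bondDartObservable E δ (1 / 3) (medialCornersAt p.1 p.2 (if p.2 = 0 then 1 else 0)) + bondDartObservable E δ (1 / 3) (medialCornersAt p.1 p.2 (if p.2 = 0 then 3 else 2)) = (2 + Complex.exp (-(Real.pi / 6 : ℝ) * Complex.I) ^ 2) * onceChiralObs E δ (1 / 3) (medialVertexOf p) true + (2 + Complex.exp ((Real.pi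 / 6 : ℝ) * Complex.I) ^ 2) * onceChiralObs E δ (1 / 3) (medialVertexOf p) false :=
  fun _ hE hH p hp _ hδ => inTemplateIdentity hE hH p hp hδ

/-- **Registered one-line form of `outTemplateIdentity`**: the leaving spin-`1/3` dart observables at an interior medial
vertex of hole-free admissible data add up to `(2λ + λ̄) Z_L + (2λ̄ + λ) Z_R` (exact, finite).
[cite: Zhou2024SLE6BondZ2, eq. (102)] -/
theorem stub_outTemplateIdentity : ∀ (E : DiscreteDobrushin), E.IsZdAdmissible → HoleFree {f : Site 2 | E.IsInnerFace f} → ∀ p : Site 2 × Fin 2, (medialVertexOf p ∈ (discreteDomainGraph E.Ω E.δ).edgeSet ∧ (∀ x ∈ medialVertexOf p, x ∉ E.zdArcA ∧ x ∉ E.zdArcB) ∧ ∀ f : Site 2, IsCorner p.1 f → IsCorner (p.1 + Pi.single p.2 1) f → E.IsInnerFace f) → ∀ δ : ℝ, 0 < δ → bondDartObservable E δ (1 / 3) (medialCornersAt p.1 p.2 (if p.2 = 0 then 0 else 1)) + bondDartObservable E δ (1 / 3) (medialCornersAt p.1 p.2 (if p.2 = 0 then 2 else 3)) = (2 * Complex.exp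 (-(Real.pi / 6 : ℝ) * Complex.I) + Complex.exp ((Real.pi / 6 : ℝ) * Complex.I)) * onceChiralObs E δ (1 / 3) (medialVertexOf p) true + (2 * Complex.exp ((Real.pi / 6 : ℝ) * Complex.I) + Complex.exp (-(Real.pi / 6 : ℝ) * Complex.I)) * onceChiralObs E δ (1 / 3) (medialVertexOf p) false :=
  fun _ hE hH p hp _ hδ => outTemplateIdentity hE hH p hp hδ

end Summit.CriticalPhenomena.CardyFormulaZ2.Theorems.WeakHolomorphy.SplitBypass

end
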